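import Literature.RingTheory.MvPolynomial.GenericTwoByNMinors
import Literature.AlgebraicGeometry.Kloosterman2025.ScrollFibreHilbertFunction
import Literature.AlgebraicGeometry.Kloosterman2025.IntegralGeneralFibres
import HarnessLib

/-!
# Kloosterman 2025, Remark 6.7: the general fibre `I_t` (2 × 2 minors of `A_t`) is INTEGRAL in the iterated-cone
# range (`k ≥ 4`), its Hilbert function one step beyond it (`k = 3`: cubic sixfolds), and its degree (quartic)

R. Kloosterman, *On a conjecture on Hodge loci of linear combinations of linear subvarieties*, Rend. Circ. Mat.
Palermo (2) 74 (2025) = arXiv:2312.12363 [cite: Kloosterman2025, Remark 6.7] (text read: `paper:arxiv-2312.12363`, p. 17):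

> **Remark 6.7.** […] Consider `A_t` the matrix `((−L₁₅, L₀₅, x₃, x₄), (x₀, x₁, −tL₂₄, tL₂₃))`. Then the ideal `I_t`
> of `2 × 2` minors of `A_t` […] In this case we have a degeneration of a quartic subscheme, whereas in the above proof
> we used a quintic subscheme. If we work with cubic fourfolds, i.e., `k = 2`, […]

The Rem. 6.7 companion of `IntegralGeneralFibres.lean` (which treats Prop. 6.4 and proves the general tools:
`isPrime_map_aeval_sup_span_of_linearIndependent` is in `GeneralFibreHilbertFunctions`, the one-relation theorem
`hilbert_map_aeval_sup_span_of_linearIndependent_erase` and `exists_hilbertPolynomial_of_chi` in `IntegralGeneralFibres`);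
the model facts are the tree's `GenericTwoByNMinors.isPrime_twoMinorIdeal` (`R₂` is a domain
[cite: BrunsHerzog1998, Thm. 7.3.1 (c)]) and `hilbert_twoMinorIdeal_chi`; the cone-range Hilbert function is
`ScrollFibreHilbertFunction.hilbert_scrollFibreIdeal_of_linearIndependent`. THIS FILE (honest framing: certified
instances and evidence bearing on the general Hodge conjecture; no claim):

* **`isPrime_scrollFibreIdeal_of_linearIndependent`** — `I_t + (x_T)` is PRIME when the eight entries of `A_t` ∪ `x_T`
  are linearly independent (`Y_t` integral; iterated cone over the quartic scroll `ℙ¹ × ℙ³`);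
* **`hilbert_scrollFibreIdeal_of_linearIndependent_erase`** (`#T + 6 ≤ n`, printed `k = 3`, CUBIC SIXFOLDS: eight
  entries minus one ∪ `x_T` independent ⇒ `h = χ_w + 3χ_w(·−1)`, `w = n − 2 − #T`) and
  `remark_6_7_hilbert_fibre_eq_hilbert_limit_erase` (= `h` of the tree's `scrollLimitIdeal T`);
* degrees [cite: BrunsHerzog1998, Def. 4.1.5]: **`remark_6_7_fibre_quartic`** / `remark_6_7_fibre_quartic_erase`
  (Hilbert polynomial of degree `n − 3 − #T`, `(n−3−#T)!·lc = 4`: "a quartic subscheme");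
* printed coordinates (`ℙ^{2k+1}`, tail = the tree's `tailVars k (k+4)`): **`remark_6_7_hilbert_fibre`** (`k ≥ 4`) /
  **`remark_6_7_hilbert_fibre_erase`** (`k ≥ 3`) (`= χ_{k+1} + 3χ_{k+1}(·−1)`, the value of the tree's
  `remark_6_7_hilbert_limit`), `remark_6_7_fibre_isPrime` (`k ≥ 4`), `remark_6_7_fibre_dim_degree` (degree `k`,
  `k!·lc = 4`).

Scope (what is NOT covered): `k = 2` (cubic fourfolds: two relations, a codimension-2 linear section of the scroll
cone — needs Cohen–Macaulayness; not formalised), integrality of the `k = 3` sections, flatness over `K[t]`, classes.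
0 sorry; no named facts.

## References

* [Kloosterman2025] R. Kloosterman, arXiv:2312.12363 = Rend. Circ. Mat. Palermo (2) 74 (2025), Remark 6.7.
* [BrunsHerzog1998] W. Bruns, J. Herzog, *Cohen–Macaulay Rings*, rev. ed. (1998), Def. 4.1.5, Remark 4.1.11,
  Thm. 7.3.1 (c), proof of Thm. 7.3.6.
-/

noncomputable section

open MvPolynomial Module

attribute [local instance] MvPolynomial.gradedAlgebra

namespace Literature.AlgebraicGeometry.Kloosterman2025

open Literature.RingTheory.MvPolynomial Literature.RingTheory.HilbertSamuel

universe u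

variable {K : Type u} [Field K] {n : ℕ}

/-! ## §0' Remark 6.7: the general fibre ideal `I_t + (x_T)` is prime (iterated-cone range) -/

section Rem67Prime

variable (T : Finset (Fin (n + 1))) (i₀ i₁ i₃ i₄ : Fin (n + 1)) (L₀₅ L₁₅ L₂₃ L₂₄ : MvPolynomial (Fin (n + 1)) K)
  (t : K)

open Literature.RingTheory.MvPolynomial.GenericTwoByNMinors in
/-- **The general fibre of Remark 6.7 is integral (iterated-cone range)**: if the eight entries of `A_t` together with
the tail coordinates `x_T` are linearly independent linear forms, then the ideal `I_t + (x_T)` of `2 × 2` minors of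
`A_t` plus the tail is a prime ideal of `K[x_0, …, x_n]` (the `2 × 4` determinantal ring `R₂` — the cone over the
quartic scroll `ℙ¹ × ℙ³ ⊂ ℙ⁷` — is a domain, `GenericTwoByNMinors.isPrime_twoMinorIdeal`, and primality survives
the base change). [cite: Kloosterman2025, Remark 6.7 ("a degeneration of a quartic subscheme")]
[cite: BrunsHerzog1998, Thm. 7.3.1 (c) (R_{r+1}(X) is a domain)] -/
theorem isPrime_scrollFibreIdeal_of_linearIndependent
    (hL : ∀ s, (scrollSubst i₀ i₁ i₃ i₄ L₀₅ L₁₅ L₂₃ L₂₄ t s).IsHomogeneous 1)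
    (hli : LinearIndependent K (Sum.elim (scrollSubst i₀ i₁ i₃ i₄ L₀₅ L₁₅ L₂₃ L₂₄ t)
      (fun s : T => (X (s : Fin (n + 1)) : MvPolynomial (Fin (n + 1)) K)))) :
    (scrollFibreIdeal T i₀ i₁ i₃ i₄ L₀₅ L₁₅ L₂₃ L₂₄ t).IsPrime := by
  have hX : Ideal.span (X '' (T : Set (Fin (n + 1)))) =
      Ideal.span (Set.range fun s : T => (X (s : Fin (n + 1)) : MvPolynomial (Fin (n + 1)) K)) := by
    rw [Set.image_eq_range]
    rfl
  rw [scrollFibreIdeal, hX]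
  haveI := isPrime_twoMinorIdeal (K := K) (n := 4)
  exact isPrime_map_aeval_sup_span_of_linearIndependent (twoMinorIdeal K 4) _ _ hL (fun _ => isHomogeneous_X K _) hli

end Rem67Prime

/-! ## §1' Remark 6.7, one linear relation (`k = 3`): the general fibre as a hyperplane section of the integral cone -/

section OneRelationConcrete

local notation "𝓗(" I ", " m ")" =>
  (((finrank K (homogeneousSubmodule (Fin (n + 1)) K m) - finrank K (idealDegree I m) : ℕ) : ℤ))

variable (T : Finset (Fin (n + 1)))

section Rem67

variable (i₀ i₁ i₃ i₄ : Fin (n + 1)) (L₀₅ L₁₅ L₂₃ L₂₄ : MvPolynomial (Fin (n + 1)) K) (t : K)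

open Literature.RingTheory.MvPolynomial.GenericTwoByNMinors Literature.AlgebraicGeometry.Kloosterman2023 in
/-- **Remark 6.7, the general fibre ONE STEP BEYOND the iterated-cone range** (printed case `k = 3`: CUBIC SIXFOLDS
in `ℙ⁷`, `T = {7}`): if the eight entries of `A_t` with ONE of them (`s₀`) removed, together with the tail
coordinates `x_T`, are linearly independent (`#T + 6 ≤ n`), then still `h_{I_t + (x_T)}(m) = χ_w(m) + 3χ_w(m−1)`,
`w = n − 2 − #T` — a hyperplane section of the integral iterated cone over the quartic scroll `ℙ¹ × ℙ³`.
[cite: Kloosterman2025, Remark 6.7] [cite: BrunsHerzog1998, Remark 4.1.11] -/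
theorem hilbert_scrollFibreIdeal_of_linearIndependent_erase (s₀ : Fin (4 + 4))
    (hL : ∀ s, (scrollSubst i₀ i₁ i₃ i₄ L₀₅ L₁₅ L₂₃ L₂₄ t s).IsHomogeneous 1)
    (hli : LinearIndependent K (Sum.elim
      (fun s : {s : Fin (4 + 4) // s ≠ s₀} => scrollSubst i₀ i₁ i₃ i₄ L₀₅ L₁₅ L₂₃ L₂₄ t s)
      (fun r : T => (X (r : Fin (n + 1)) : MvPolynomial (Fin (n + 1)) K))))
    (hT : T.card + 6 ≤ n) (m : ℕ) :
    𝓗(scrollFibreIdeal T i₀ i₁ i₃ i₄ L₀₅ L₁₅ L₂₃ L₂₄ t, m) =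
      chi (n - 2 - T.card) m + 3 * chi (n - 2 - T.card) ((m : ℤ) - 1) := by
  classical
  have hX : Ideal.span (X '' (T : Set (Fin (n + 1)))) =
      Ideal.span (Set.range fun r : T => (X (r : Fin (n + 1)) : MvPolynomial (Fin (n + 1)) K)) := by
    rw [Set.image_eq_range]
    rfl
  rw [scrollFibreIdeal, hX]
  haveI := isPrime_twoMinorIdeal (K := K) (n := 4)
  have h := hilbert_map_aeval_sup_span_of_linearIndependent_erase (twoMinorIdeal K 4) isHomogeneous_twoMinorIdeal
    (v := 5) (by norm_num) 3 0 (fun d => by simpa using hilbert_twoMinorIdeal_chi (K := K) (n := 4) (by norm_num) d)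
    (by rw [Fintype.card_fin]; norm_num) _ _ hL (fun _ => isHomogeneous_X K _) s₀ hli
    (by rw [Fintype.card_fin, Fintype.card_coe]; omega) m
  rw [Fintype.card_fin, Fintype.card_coe, show 5 + (n + 1 + 1 - (4 + 4 + T.card)) - 1 = n - 2 - T.card by omega] at h
  simpa using h

variable {T i₀ i₁ i₃ i₄ L₀₅ L₁₅ L₂₃ L₂₄ t}

open Literature.AlgebraicGeometry.Kloosterman2023 in
/-- **The Hilbert functions of `I_t` and of its limit coincide (Remark 6.7), one step beyond the iterated-cone range**
(`#T + 6 ≤ n`, printed case `k = 3`, cubic sixfolds): same comparison with the tree's `scrollLimitIdeal T` as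
`remark_6_7_hilbert_fibre_eq_hilbert_limit`, under "eight entries minus one ∪ `x_T` independent".
[cite: Kloosterman2025, Remark 6.7] -/
theorem remark_6_7_hilbert_fibre_eq_hilbert_limit_erase {N M : MvPolynomial (Fin (n + 1)) K} (s₀ : Fin (4 + 4))
    (hL : ∀ s, (scrollSubst i₀ i₁ i₃ i₄ L₀₅ L₁₅ L₂₃ L₂₄ t s).IsHomogeneous 1)
    (hli : LinearIndependent K (Sum.elim
      (fun s : {s : Fin (4 + 4) // s ≠ s₀} => scrollSubst i₀ i₁ i₃ i₄ L₀₅ L₁₅ L₂₃ L₂₄ t s)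
      (fun r : T => (X (r : Fin (n + 1)) : MvPolynomial (Fin (n + 1)) K))))
    (hT : T.card + 6 ≤ n)
    (h₀₁ : i₀ ≠ i₁) (h₀₃ : i₀ ≠ i₃) (h₀₄ : i₀ ≠ i₄) (h₁₃ : i₁ ≠ i₃) (h₁₄ : i₁ ≠ i₄) (h₃₄ : i₃ ≠ i₄)
    (hi₀ : i₀ ∉ T) (hi₁ : i₁ ∉ T) (hi₃ : i₃ ∉ T) (hi₄ : i₄ ∉ T)
    (hNA : N ∈ Ideal.span {(X i₀ : MvPolynomial (Fin (n + 1)) K), X i₁})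
    (hMB : M ∈ Ideal.span {(X i₃ : MvPolynomial (Fin (n + 1)) K), X i₄})
    (hNh : N.IsHomogeneous 2) (hMh : M.IsHomogeneous 2)
    (hM : M ∉ Ideal.span (X '' (({i₀, i₁} : Set (Fin (n + 1))) ∪ ↑T)))
    (hN : N ∉ Ideal.span (X '' (({i₃, i₄} : Set (Fin (n + 1))) ∪ ↑T)))
    (m : ℕ) :
    𝓗(scrollFibreIdeal T i₀ i₁ i₃ i₄ L₀₅ L₁₅ L₂₃ L₂₄ t, m) = 𝓗(scrollLimitIdeal T i₀ i₁ i₃ i₄ N M, m) := by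
  rw [hilbert_scrollFibreIdeal_of_linearIndependent_erase T i₀ i₁ i₃ i₄ L₀₅ L₁₅ L₂₃ L₂₄ t s₀ hL hli hT m,
    hilbert_scrollLimitIdeal_eq_scrollSection h₀₁ h₀₃ h₀₄ h₁₃ h₁₄ h₃₄ hi₀ hi₁ hi₃ hi₄ hNA hMB hNh hMh hM hN
      (by omega) m]

end Rem67
end OneRelationConcrete

/-! ## §2' Degree: `Y_t` (Remark 6.7) is a quartic of dimension `k` -/

section DegreeConcrete

open scoped Polynomial

local notation "𝓗ℚ(" I ", " m ")" =>
  (((finrank K (homogeneousSubmodule (Fin (n + 1)) K m) - finrank K (idealDegree I m) : ℕ) : ℚ))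

variable (T : Finset (Fin (n + 1)))

/-- **`Y_t` (Remark 6.7) is a QUARTIC of dimension `k`**: in the iterated-cone range, the Hilbert polynomial of
`K[x]/(I_t + (x_T))` has degree `n − 3 − #T` (`= k`) and `(n−3−#T)!`·(leading coefficient) `= 4` — "a degeneration
of a quartic subscheme" (degree `4 = 1 + 3`, the `h`-vector of the scroll). [cite: Kloosterman2025, Remark 6.7 ("a
degeneration of a quartic subscheme")] -/
theorem remark_6_7_fibre_quartic (i₀ i₁ i₃ i₄ : Fin (n + 1)) (L₀₅ L₁₅ L₂₃ L₂₄ : MvPolynomial (Fin (n + 1)) K) (t : K)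
    (hL : ∀ s, (scrollSubst i₀ i₁ i₃ i₄ L₀₅ L₁₅ L₂₃ L₂₄ t s).IsHomogeneous 1)
    (hli : LinearIndependent K (Sum.elim (scrollSubst i₀ i₁ i₃ i₄ L₀₅ L₁₅ L₂₃ L₂₄ t)
      (fun s : T => (X (s : Fin (n + 1)) : MvPolynomial (Fin (n + 1)) K))))
    (hT : T.card + 7 ≤ n) :
    ∃ P : ℚ[X], (∀ m : ℕ, 2 ≤ m → 𝓗ℚ(scrollFibreIdeal T i₀ i₁ i₃ i₄ L₀₅ L₁₅ L₂₃ L₂₄ t, m) = P.eval (m : ℚ)) ∧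
      P.natDegree = n - 3 - T.card ∧ (((n - 3 - T.card).factorial : ℕ) : ℚ) * P.leadingCoeff = 4 := by
  have h := exists_hilbertPolynomial_of_chi (scrollFibreIdeal T i₀ i₁ i₃ i₄ L₀₅ L₁₅ L₂₃ L₂₄ t)
    (w := n - 2 - T.card) (by omega) 1 3 0 (by norm_num)
    (fun m => by simpa using hilbert_scrollFibreIdeal_of_linearIndependent T i₀ i₁ i₃ i₄ L₀₅ L₁₅ L₂₃ L₂₄ t hL hli hT m)
  rw [show n - 2 - T.card - 1 = n - 3 - T.card by omega] at h
  norm_num at h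
  exact h

/-- The same one step beyond the cone range (`#T + 6 ≤ n`, printed `k = 3`: cubic sixfolds).
[cite: Kloosterman2025, Remark 6.7 ("a degeneration of a quartic subscheme")] -/
theorem remark_6_7_fibre_quartic_erase (i₀ i₁ i₃ i₄ : Fin (n + 1)) (L₀₅ L₁₅ L₂₃ L₂₄ : MvPolynomial (Fin (n + 1)) K)
    (t : K) (s₀ : Fin (4 + 4)) (hL : ∀ s, (scrollSubst i₀ i₁ i₃ i₄ L₀₅ L₁₅ L₂₃ L₂₄ t s).IsHomogeneous 1)
    (hli : LinearIndependent K (Sum.elim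
      (fun s : {s : Fin (4 + 4) // s ≠ s₀} => scrollSubst i₀ i₁ i₃ i₄ L₀₅ L₁₅ L₂₃ L₂₄ t s)
      (fun r : T => (X (r : Fin (n + 1)) : MvPolynomial (Fin (n + 1)) K))))
    (hT : T.card + 6 ≤ n) :
    ∃ P : ℚ[X], (∀ m : ℕ, 2 ≤ m → 𝓗ℚ(scrollFibreIdeal T i₀ i₁ i₃ i₄ L₀₅ L₁₅ L₂₃ L₂₄ t, m) = P.eval (m : ℚ)) ∧
      P.natDegree = n - 3 - T.card ∧ (((n - 3 - T.card).factorial : ℕ) : ℚ) * P.leadingCoeff = 4 := by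
  have h := exists_hilbertPolynomial_of_chi (scrollFibreIdeal T i₀ i₁ i₃ i₄ L₀₅ L₁₅ L₂₃ L₂₄ t)
    (w := n - 2 - T.card) (by omega) 1 3 0 (by norm_num)
    (fun m => by
      simpa using hilbert_scrollFibreIdeal_of_linearIndependent_erase T i₀ i₁ i₃ i₄ L₀₅ L₁₅ L₂₃ L₂₄ t s₀ hL hli hT m)
  rw [show n - 2 - T.card - 1 = n - 3 - T.card by omega] at h
  norm_num at h
  exact h

end DegreeConcrete

/-! ## §3' The printed coordinates: `ℙ^{2k+1}`, tail `x_{k+4}, …, x_{2k+1}` -/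

section Printed

local notation "𝓗ₖ(" k' ", " I ", " m ")" =>
  (((finrank K (homogeneousSubmodule (Fin (2 * k' + 2)) K m) - finrank K (idealDegree I m) : ℕ) : ℤ))

/-- The tail `x_a, …, x_{2k+1}` has `2k + 2 − a` coordinates (as in the tree's `FlatLimitHilbertFunctions`, private
there). [folklore] -/
private theorem card_tailVars'' (k a : ℕ) : (tailVars k a).card = 2 * k + 2 - a := by
  have h : (tailVars k a).map Fin.valEmbedding = Finset.Ico a (2 * k + 2) := by
    ext l
    simp only [Finset.mem_map, Fin.valEmbedding_apply, Finset.mem_Ico, tailVars, Finset.mem_filter, Finset.mem_univ,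
      true_and]
    constructor
    · rintro ⟨x, hx, rfl⟩
      exact ⟨hx, x.isLt⟩
    · rintro ⟨hal, hl⟩
      exact ⟨⟨l, hl⟩, hal, rfl⟩
  rw [← Finset.card_map Fin.valEmbedding, h, Nat.card_Ico]

open Literature.AlgebraicGeometry.Kloosterman2023 in
/-- **Remark 6.7, the general fibre `I_t`, `t ≠ 0`, in the printed coordinates, `k ≥ 4`**: if the eight entries of
`A_t` together with `x_{k+4}, …, x_{2k+1}` are linearly independent, then `h_{I_t + (x_{k+4},…)}(m) = χ_{k+1}(m) + 3χ_{k+1}(m−1)`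
— the value of the central fibre (the tree's `remark_6_7_hilbert_limit`). [cite: Kloosterman2025, Remark 6.7] -/
theorem remark_6_7_hilbert_fibre {k : ℕ} (hk : 4 ≤ k) (L₀₅ L₁₅ L₂₃ L₂₄ : MvPolynomial (Fin (2 * k + 2)) K) (t : K)
    (hL : ∀ s, (scrollSubst (n := 2 * k + 1) ⟨0, by omega⟩ ⟨1, by omega⟩ ⟨3, by omega⟩ ⟨4, by omega⟩
      L₀₅ L₁₅ L₂₃ L₂₄ t s).IsHomogeneous 1)
    (hli : LinearIndependent K (Sum.elim
      (scrollSubst (n := 2 * k + 1) ⟨0, by omega⟩ ⟨1, by omega⟩ ⟨3, by omega⟩ ⟨4, by omega⟩ L₀₅ L₁₅ L₂₃ L₂₄ t)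
      (fun r : tailVars k (k + 4) => (X (r : Fin (2 * k + 2)) : MvPolynomial (Fin (2 * k + 2)) K))))
    (m : ℕ) :
    𝓗ₖ(k, scrollFibreIdeal (tailVars k (k + 4)) ⟨0, by omega⟩ ⟨1, by omega⟩ ⟨3, by omega⟩ ⟨4, by omega⟩
        L₀₅ L₁₅ L₂₃ L₂₄ t, m) =
      chi (k + 1) m + 3 * chi (k + 1) ((m : ℤ) - 1) := by
  have hcard : (tailVars k (k + 4)).card = k - 2 := by rw [card_tailVars'']; omega
  have h := hilbert_scrollFibreIdeal_of_linearIndependent (n := 2 * k + 1) (tailVars k (k + 4)) ⟨0, by omega⟩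
    ⟨1, by omega⟩ ⟨3, by omega⟩ ⟨4, by omega⟩ L₀₅ L₁₅ L₂₃ L₂₄ t hL hli (by rw [hcard]; omega) m
  rw [hcard, show 2 * k + 1 - 2 - (k - 2) = k + 1 by omega] at h
  exact h

open Literature.AlgebraicGeometry.Kloosterman2023 in
/-- **The same for `k ≥ 3`** (cubic sixfolds and up) under "eight entries minus one (`s₀`) ∪ tail independent".
[cite: Kloosterman2025, Remark 6.7] -/
theorem remark_6_7_hilbert_fibre_erase {k : ℕ} (hk : 3 ≤ k) (L₀₅ L₁₅ L₂₃ L₂₄ : MvPolynomial (Fin (2 * k + 2)) K)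
    (t : K) (s₀ : Fin (4 + 4))
    (hL : ∀ s, (scrollSubst (n := 2 * k + 1) ⟨0, by omega⟩ ⟨1, by omega⟩ ⟨3, by omega⟩ ⟨4, by omega⟩
      L₀₅ L₁₅ L₂₃ L₂₄ t s).IsHomogeneous 1)
    (hli : LinearIndependent K (Sum.elim
      (fun s : {s : Fin (4 + 4) // s ≠ s₀} => scrollSubst (n := 2 * k + 1) ⟨0, by omega⟩ ⟨1, by omega⟩ ⟨3, by omega⟩
        ⟨4, by omega⟩ L₀₅ L₁₅ L₂₃ L₂₄ t s)
      (fun r : tailVars k (k + 4) => (X (r : Fin (2 * k + 2)) : MvPolynomial (Fin (2 * k + 2)) K))))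
    (m : ℕ) :
    𝓗ₖ(k, scrollFibreIdeal (tailVars k (k + 4)) ⟨0, by omega⟩ ⟨1, by omega⟩ ⟨3, by omega⟩ ⟨4, by omega⟩
        L₀₅ L₁₅ L₂₃ L₂₄ t, m) =
      chi (k + 1) m + 3 * chi (k + 1) ((m : ℤ) - 1) := by
  have hcard : (tailVars k (k + 4)).card = k - 2 := by rw [card_tailVars'']; omega
  have h := hilbert_scrollFibreIdeal_of_linearIndependent_erase (n := 2 * k + 1) (tailVars k (k + 4)) ⟨0, by omega⟩
    ⟨1, by omega⟩ ⟨3, by omega⟩ ⟨4, by omega⟩ L₀₅ L₁₅ L₂₃ L₂₄ t s₀ hL hli (by rw [hcard]; omega) m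
  rw [hcard, show 2 * k + 1 - 2 - (k - 2) = k + 1 by omega] at h
  exact h

/-- **`Y_t` is integral, printed coordinates, Remark 6.7, `k ≥ 4`**: `I_t + (x_{k+4}, …, x_{2k+1})` is prime when the
eight entries of `A_t` ∪ tail are linearly independent. [cite: Kloosterman2025, Remark 6.7 ("a quartic subscheme")] -/
theorem remark_6_7_fibre_isPrime {k : ℕ} (hk : 4 ≤ k) (L₀₅ L₁₅ L₂₃ L₂₄ : MvPolynomial (Fin (2 * k + 2)) K) (t : K)
    (hL : ∀ s, (scrollSubst (n := 2 * k + 1) ⟨0, by omega⟩ ⟨1, by omega⟩ ⟨3, by omega⟩ ⟨4, by omega⟩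
      L₀₅ L₁₅ L₂₃ L₂₄ t s).IsHomogeneous 1)
    (hli : LinearIndependent K (Sum.elim
      (scrollSubst (n := 2 * k + 1) ⟨0, by omega⟩ ⟨1, by omega⟩ ⟨3, by omega⟩ ⟨4, by omega⟩ L₀₅ L₁₅ L₂₃ L₂₄ t)
      (fun r : tailVars k (k + 4) => (X (r : Fin (2 * k + 2)) : MvPolynomial (Fin (2 * k + 2)) K)))) :
    (scrollFibreIdeal (tailVars k (k + 4)) ⟨0, by omega⟩ ⟨1, by omega⟩ ⟨3, by omega⟩ ⟨4, by omega⟩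
      L₀₅ L₁₅ L₂₃ L₂₄ t).IsPrime :=
  isPrime_scrollFibreIdeal_of_linearIndependent (n := 2 * k + 1) (tailVars k (k + 4)) _ _ _ _ _ _ _ _ _ hL hli

open scoped Polynomial in
/-- **`Y_t` (Remark 6.7) has dimension `k` and degree `4`, printed coordinates, `k ≥ 4`.**
[cite: Kloosterman2025, Remark 6.7 ("a degeneration of a quartic subscheme")] -/
theorem remark_6_7_fibre_dim_degree {k : ℕ} (hk : 4 ≤ k) (L₀₅ L₁₅ L₂₃ L₂₄ : MvPolynomial (Fin (2 * k + 2)) K) (t : K)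
    (hL : ∀ s, (scrollSubst (n := 2 * k + 1) ⟨0, by omega⟩ ⟨1, by omega⟩ ⟨3, by omega⟩ ⟨4, by omega⟩
      L₀₅ L₁₅ L₂₃ L₂₄ t s).IsHomogeneous 1)
    (hli : LinearIndependent K (Sum.elim
      (scrollSubst (n := 2 * k + 1) ⟨0, by omega⟩ ⟨1, by omega⟩ ⟨3, by omega⟩ ⟨4, by omega⟩ L₀₅ L₁₅ L₂₃ L₂₄ t)
      (fun r : tailVars k (k + 4) => (X (r : Fin (2 * k + 2)) : MvPolynomial (Fin (2 * k + 2)) K)))) :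
    ∃ P : ℚ[X], (∀ m : ℕ, 2 ≤ m →
        (((finrank K (homogeneousSubmodule (Fin (2 * k + 2)) K m) -
          finrank K (idealDegree (scrollFibreIdeal (tailVars k (k + 4)) ⟨0, by omega⟩ ⟨1, by omega⟩ ⟨3, by omega⟩
            ⟨4, by omega⟩ L₀₅ L₁₅ L₂₃ L₂₄ t) m) : ℕ) : ℚ)) = P.eval (m : ℚ)) ∧
      P.natDegree = k ∧ ((k.factorial : ℕ) : ℚ) * P.leadingCoeff = 4 := by
  have hcard : (tailVars k (k + 4)).card = k - 2 := by rw [card_tailVars'']; omega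
  have h := remark_6_7_fibre_quartic (n := 2 * k + 1) (tailVars k (k + 4)) ⟨0, by omega⟩ ⟨1, by omega⟩ ⟨3, by omega⟩
    ⟨4, by omega⟩ L₀₅ L₁₅ L₂₃ L₂₄ t hL hli (by rw [hcard]; omega)
  rw [hcard, show 2 * k + 1 - 3 - (k - 2) = k by omega] at h
  exact h

end Printed

end Literature.AlgebraicGeometry.Kloosterman2025
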